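import Summits.HodgeConjecture.HodgeConjecture.Theorems.R90S1BranchBClosedFormsRamified        -- ★∕📤 (this seat) ramified (II)-c part 2: `h11v`, `hwwv` from the ramified shell identities; brings ★ part 1 (`hi₁₁`, `hiw₂`, `chi2_neg_one_sq`)
import Summits.HodgeConjecture.HodgeConjecture.Theorems.R90S1BranchBAssemblyRamified           -- ★ (this seat) reducible + big-cell entries ⟹ `∃ η` at a ramified place; brings ★ `R90S1BranchBConstantsRamified` (`|X| < 1`)
import Summits.HodgeConjecture.HodgeConjecture.Theorems.K2E3BranchBTypeBasisCM                  -- ★ (K2E3-p32) the normalised `(I, χ̃)`-type basis exists in Branch B at depth zero (place-generic)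
import Summits.HodgeConjecture.HodgeConjecture.Theorems.K2E3BranchBShellRegions                 -- ★ (K2E3-p32) the shell regions are Borel (place-generic)
import HarnessLib

/-!
# R90 · S1 ∕ U4Keys leaf (U4f-χ₁-ram-one-d0B) — THE SOCKET :155 AT A (TAME) RAMIFIED PLACE, MODULO THE THREE RAMIFIED SHELL IDENTITIES OF PAPER-Z3-DepthZeroRamified §1:
# `i(χ₁, 1)` reducible (χ₁ contracting, non-unitary, depth zero, Branch B, ramified; `v` non-split, `w ∣ v` ramified, `|2|_w = 1`) ⟹ `χ₁ = η · ‖·‖^{1∕2}`, `η` a quadratic character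
# extension — given, on the frame-v1 integrand `F₀(n) = χ₁((σz)⁻¹)‖z‖⁻¹` of `N(L⁺_v)`: the torus scaling by `Π` `∫_{S_ge} = ∫_{Sh 0} + ∫_{Sh 1} + X·∫_{S_ge}` (`X = χ₁(σΠ·Π)`), the odd shell
# `∫_{Sh 1} = 0`, the shell zero `∫_{Sh 0} = c₀·((q−1)∕q)·V`
# [Keys1984 §3, §7 Thm (2) (d); Casselman1980 §3; Casselman1995 §6.4, Thm. 6.6.2; Rogawski1990 §12.1–§12.2; Roche1998 §3–§4; PAPER-Z3-DepthZeroRamified §1–§2 (R90-C10-p05 (g0), r01-screened)]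

Cell `hodgecm-mathlib`, SLAB R90-TF, section S1 «Ch. 12 local», crux H413 = `stmt-HodgeConjecture-24833` (lane `--supports … --as helper`), route HCCMUnconditional; prover seat
`hodgecm-mathlib-R90-C10-p05` (g0); socket of record S1#3′ = K2E3 leaf (U4f-χ₁-ram-one) ⊇ U4Keys :155 (depth 0, Branch B).  THEOREMS ONLY (no definition ∕ instance ∕ notation ∕
named fact ∕ `sorry`); ★-only imports.  The RAMIFIED twin of ★ `K2E3KeysThmTwoDepthZeroBranchBInert` (K2E3-p32), in the SAME (G3) frame `L v w hw eA heA ϖ hϖ g₁ hg₁ K0 K1 I hK0 hK1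
hI w₀ hw₀`, on the SAME regions and the SAME integrand; the hypotheses `hscal`, `h1`, `h0` have the inert LHS bytes and the ramified RHS (`X·∫` for `Y²·∫`, `0`, `c₀·((q−1)∕q)·V`).
NOT THE PAYER: the three ramified shell identities (the ramified (II)-a ∕ (II)-b, UNFILED), `IntegrableOn F₀ S_ge` and the sign letter `c₀² = 1` remain hypotheses; inert places are ★
`K2E3KeysThmTwoDepthZeroBranchBInert`, dyadic ramified places are vacuous (★ `R90S1RamifiedDyadicDepthZeroBranchBVacuous`).
THE POINT.  Everything else of PAPER-Z3-DepthZeroRamified's Branch-B proof is ★ by name; this module composes it into ONE basis-free statement: ★ `K2E3BranchBTypeBasisCM` → ★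
`R90S1BranchBClosedFormsRamified` (`h11v`, `hwwv`) + ★ `K2E3BranchBCasselmanPairEntries` (`hi₁₁`, `hiw₂`, `chi2_neg_one_sq`) → ★ `R90S1BranchBAssemblyRamified` (reducible ⟹ type vector
⟹ `det M = 0` ⟹ roots `(1 − q·X)(q − X) = 0` ⟹ `X = q⁻¹` ⟹ Z5-ram conversion ⟹ `η`).
* **`exists_eta_of_reducible_of_shells_ram`**, **`exists_eta_of_reducible_of_shellIdentities_ram`** (regions discharged).
HONEST LABEL.  HC_CM is proved only modulo the 7 printed citations (2 remaining named inputs: hLiu418 = `stmt-HodgeConjecture-24832`, h413 = `stmt-HodgeConjecture-24833`) until rung 0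
closes; count-neutral — this file does NOT pay the leaf; no printed citation is discharged.

## References
* [Keys1984] D. Keys, *Principal series representations of special unitary groups over local fields*, Compositio Math. 51 (1984), §3, §7 Theorem (2) (d) p. 126.
* [Casselman1980] W. Casselman, *The unramified principal series of p-adic groups I*, Compositio Math. 40 (1980), §3.
* [Casselman1995] W. Casselman, *Introduction to the theory of admissible representations of `p`-adic reductive groups* (1995), §6.4, Thm. 6.6.2.
* [Rogawski1990] J. D. Rogawski, *Automorphic Representations of Unitary Groups in Three Variables*, Ann. of Math. Stud. 123 (1990), §12.1 p. 171, §12.2 (1)–(2) p. 173.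
* [Roche1998] A. Roche, *Types and Hecke algebras for principal series representations of split reductive p-adic groups*, Ann. Sci. ÉNS (4) 31 (1998), §3–§4.
-/

set_option autoImplicit false
-- the mandated namespace has the single-problem summit's repeated segment (`HodgeConjecture.HodgeConjecture`)
set_option linter.dupNamespace false

noncomputable section

open NumberField IsDedekindDomain MeasureTheory
open scoped Matrix MatrixGroups WithZero Valued NNReal
open Literature.NumberTheory Literature.NumberTheory.Automorphic Literature.NumberTheory.Automorphic.UnitaryGroup
open Literature.NumberTheory.Rogawski1990

namespace Summit.HodgeConjecture.HodgeConjecture.R90.S1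

open Summit.HodgeConjecture.HodgeConjecture.Cruxes.H413
open Summit.HodgeConjecture.HodgeConjecture.Cruxes.H413.K2E3DepthZeroIwahoriCharacterCM
open Summit.HodgeConjecture.HodgeConjecture.Cruxes.H413.K2E3BranchATorusWitnessCM

variable (L : Type) [Field L] [NumberField L] [IsCMField L] (v : HeightOneSpectrum (𝓞 ↥(maximalRealSubfield L)))
  (w : PlacesOver L v) (hw : IsCMField.complexConj L • w.1 = w.1)
  (eA : Gqs L v ≃ₜ* ↥(unitaryGroupOfForm (galAdicCompletionMap (L := L) (IsCMField.complexConj L) hw) ((StdForm.antidiagonal 3).over (w.1.adicCompletion L))))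
  (heA : ∀ g : Gqs L v,
    ((eA g : ↥(unitaryGroupOfForm (galAdicCompletionMap (L := L) (IsCMField.complexConj L) hw) ((StdForm.antidiagonal 3).over (w.1.adicCompletion L)))) :
        GL (Fin 3) (w.1.adicCompletion L)) =
      ((localNonsplitEquiv (IsCMField.complexConj L) (qsForm L) (IsCMField.complexConj_ne_one L) w hw g :
        ↥(unitaryGroupOfForm (galAdicCompletionMap (L := L) (IsCMField.complexConj L) hw) (placeForm (qsForm L) w.1))) : GL (Fin 3) (w.1.adicCompletion L)))
  {ϖ : w.1.adicCompletion L} (hϖ : Valued.v ϖ = WithZero.exp (-1 : ℤ))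
  (g₁ : GL (Fin 3) (w.1.adicCompletion L)) (hg₁ : (g₁ : Matrix (Fin 3) (Fin 3) (w.1.adicCompletion L)) = Matrix.diagonal ![(1 : w.1.adicCompletion L), 1, ϖ])
  (K0 K1 I : Subgroup (Gqs L v))
  (hK0 : K0 = ((glInt 3 (w.1.adicCompletion L)).subgroupOf
    (unitaryGroupOfForm (galAdicCompletionMap (L := L) (IsCMField.complexConj L) hw) ((StdForm.antidiagonal 3).over (w.1.adicCompletion L)))).comap
      eA.toMulEquiv.toMonoidHom)
  (hK1 : K1 = (((glInt 3 (w.1.adicCompletion L)).map (MulAut.conj g₁).toMonoidHom).subgroupOf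
    (unitaryGroupOfForm (galAdicCompletionMap (L := L) (IsCMField.complexConj L) hw) ((StdForm.antidiagonal 3).over (w.1.adicCompletion L)))).comap
      eA.toMulEquiv.toMonoidHom)
  (hI : I = K0 ⊓ K1)
  (w₀ : ↥(unitaryGroupOfForm (conjLocal L (IsCMField.complexConj L) v) (cmLocalForm L 3 v))) (hw₀ : Units.val (w₀ : GL (Fin 3) (LocalRing L v)) = cmLocalForm L 3 v)

/-! ## :155 at a (tame) ramified place, modulo the three ramified shell identities -/

open Classical in
include hw heA hϖ hg₁ hK0 hK1 hI hw₀ in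
set_option maxHeartbeats 4000000 in
set_option synthInstance.maxHeartbeats 400000 in
-- the `SmoothInd` carrier on `U(Φ₃)(L⁺_v)` (class of ★ `K2E3KeysThmTwoDepthZeroBranchBInert`)
/-- **THE SOCKET :155 AT A RAMIFIED PLACE, MODULO THE THREE RAMIFIED SHELL IDENTITIES.**  (G3)-frame, `w₀` the element of matrix `Φ₃`, `μ` a Haar measure on `N(L⁺_v)`; `v` non-split,
`w ∣ v` RAMIFIED (`he`) with `|2|_w = 1` (`h2w`: the dyadic ramified corner is vacuous, ★ `R90S1RamifiedDyadicDepthZeroBranchBVacuous`); `Π` a uniformiser unit of `E_v` (`piU`, `hpiU`),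
`X := χ₁(σΠ·Π)`; `χ₁` continuous, non-unitary, contracting, trivial on principal units (depth zero), `χ₁(u·σu) = 1` on the units of valuation one (Branch B), non-trivial on the integral
units (`hram`); on the frame-v1 integrand `F₀(n) = χ₁((σz)⁻¹)·‖z‖⁻¹` (`z = n₀₂`; `0` off the units): the regions `S_gt = {|z|_w > 1}`, `S_ge = {|z|_w ≥ 1}`, `Sh 0 = {|z|_w = 1}` are Borel,
`F₀` is integrable on `S_ge`, and with a sign `c₀` (`c₀² = 1`; in use `c₀ = χ₁(−2)`), `q = N𝔭_v`, `V = μ{|z|_w ≤ 1}`: `∫_{S_ge} F₀ = ∫_{Sh 0} F₀ + ∫_{Sh 1} F₀ + X·∫_{S_ge} F₀` (torus scaling by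
`Π`), `∫_{Sh 1} F₀ = 0` (the odd shell), `∫_{Sh 0} F₀ = c₀·((q−1)∕q)·V` (shell zero) [PAPER-Z3-DepthZeroRamified §1].  If `i(χ₁, 1)` is reducible then **`χ₁ = η · ‖·‖^{1∕2}` for a
continuous quadratic character extension `η`** — the second disjunct of :155.  Proof: `|X| < 1` ★ `norm_apply_norm_uniformizer_lt_one` → ★ basis `K2E3BranchBTypeBasisCM` → ★ ramified
(II)-c heads `integral_weyl_one_eq_of_shells_ram` ∕ `integral_weyl_weyl_eq_of_shells_ram` + ★ integrabilities `integrable_toFun_weyl_mul` ∕ `integrable_toFun_conj_weyl` → ★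
`exists_eta_of_reducible_of_bigCellEntries_ram` with the sign `χ₂(−1)·c₀` (`χ₂ = 1`, ★ `chi2_neg_one_sq`). [cite: Keys1984, §3, §7 Theorem (2) (d) p. 126] [cite: Casselman1980, §3]
[cite: Casselman1995, §6.4, Thm. 6.6.2] [cite: Rogawski1990, §12.2 (1)–(2) p. 173] [cite: Roche1998, §3–§4] -/
theorem exists_eta_of_reducible_of_shells_ram
    (hns : ∀ w' : PlacesOver L v, IsCMField.complexConj L • w'.1 = w'.1)
    (he : v.asIdeal.ramificationIdx' w.1.asIdeal ≠ 1) (h2w : Valued.v (2 : w.1.adicCompletion L) = 1)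
    (piU : (LocalRing L v)ˣ) (hpiU : ∀ w' : PlacesOver L v, Valued.v ((piU : LocalRing L v) w') = WithZero.exp (-1 : ℤ))
    (χ₁ : (LocalRing L v)ˣ →* ℂˣ) (h₁ : Continuous fun x => ((χ₁ x : ℂˣ) : ℂ)) (hnu : ∃ x, ‖((χ₁ x : ℂˣ) : ℂ)‖ ≠ 1)
    (hcontr : ∀ x : (LocalRing L v)ˣ, unitModulusChar (LocalRing L v) x < 1 → ‖((χ₁ x : ℂˣ) : ℂ)‖ < 1)
    (hdepth : ∀ u : (LocalRing L v)ˣ, (∀ w' : PlacesOver L v, Valued.v (((u : LocalRing L v) w') - 1) < 1) → χ₁ u = 1)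
    (hB : ∀ u : (LocalRing L v)ˣ, (∀ w' : PlacesOver L v, Valued.v ((u : LocalRing L v) w') = 1) →
      χ₁ (u * Units.map (conjLocal L (IsCMField.complexConj L) v : LocalRing L v →* LocalRing L v) u) = 1)
    (hram : ¬ ∀ u ∈ (Submonoid.pi Set.univ (fun w' : PlacesOver L v => (w'.1.adicCompletionIntegers L).toSubring.toSubmonoid)).units, χ₁ u = 1)
    [MeasurableSpace ↥(cmBorelTriple L 3 v).N] [BorelSpace ↥(cmBorelTriple L 3 v).N] (μ : Measure ↥(cmBorelTriple L 3 v).N) [μ.IsHaarMeasure]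
    (hSgt : MeasurableSet {m : ↥(cmBorelTriple L 3 v).N | 1 < Valued.v (((((m : ↥(unitaryGroupOfForm (conjLocal L (IsCMField.complexConj L) v) (cmLocalForm L 3 v))) : GL (Fin 3) (LocalRing L v)) : Matrix (Fin 3) (Fin 3) (LocalRing L v)) 0 2) w)}) (hSge : MeasurableSet {m : ↥(cmBorelTriple L 3 v).N | 1 ≤ Valued.v (((((m : ↥(unitaryGroupOfForm (conjLocal L (IsCMField.complexConj L) v) (cmLocalForm L 3 v))) : GL (Fin 3) (LocalRing L v)) : Matrix (Fin 3) (Fin 3) (LocalRing L v)) 0 2) w)}) (hSh0 : MeasurableSet {m : ↥(cmBorelTriple L 3 v).N | Valued.v (((((m : ↥(unitaryGroupOfForm (conjLocal L (IsCMField.complexConj L) v) (cmLocalForm L 3 v))) : GL (Fin 3) (LocalRing L v)) : Matrix (Fin 3) (Fin 3) (LocalRing L v)) 0 2) w) = 1})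
    (hint : IntegrableOn (fun n : ↥(cmBorelTriple L 3 v).N =>
        if h : IsUnit ((((n : ↥(unitaryGroupOfForm (conjLocal L (IsCMField.complexConj L) v) (cmLocalForm L 3 v))) : GL (Fin 3) (LocalRing L v)) : Matrix (Fin 3) (Fin 3) (LocalRing L v)) 0 2) then
          ((((χ₁ (Units.map ((conjLocal L (IsCMField.complexConj L) v) : LocalRing L v →* LocalRing L v) h.unit))⁻¹ : ℂˣ) : ℂ) *
            ((((unitModulusChar (LocalRing L v) h.unit)⁻¹ : ℝ≥0) : ℝ) : ℂ))
        else 0) {m : ↥(cmBorelTriple L 3 v).N | 1 ≤ Valued.v (((((m : ↥(unitaryGroupOfForm (conjLocal L (IsCMField.complexConj L) v) (cmLocalForm L 3 v))) : GL (Fin 3) (LocalRing L v)) : Matrix (Fin 3) (Fin 3) (LocalRing L v)) 0 2) w)} μ)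
    (c₀ : ℂ) (hc : c₀ ^ 2 = 1)
    (hscal : ∫ n in {m : ↥(cmBorelTriple L 3 v).N | 1 ≤ Valued.v (((((m : ↥(unitaryGroupOfForm (conjLocal L (IsCMField.complexConj L) v) (cmLocalForm L 3 v))) : GL (Fin 3) (LocalRing L v)) : Matrix (Fin 3) (Fin 3) (LocalRing L v)) 0 2) w)}, (fun n : ↥(cmBorelTriple L 3 v).N =>
        if h : IsUnit ((((n : ↥(unitaryGroupOfForm (conjLocal L (IsCMField.complexConj L) v) (cmLocalForm L 3 v))) : GL (Fin 3) (LocalRing L v)) : Matrix (Fin 3) (Fin 3) (LocalRing L v)) 0 2) then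
          ((((χ₁ (Units.map ((conjLocal L (IsCMField.complexConj L) v) : LocalRing L v →* LocalRing L v) h.unit))⁻¹ : ℂˣ) : ℂ) *
            ((((unitModulusChar (LocalRing L v) h.unit)⁻¹ : ℝ≥0) : ℝ) : ℂ))
        else 0) n ∂μ =
      (∫ n in {m : ↥(cmBorelTriple L 3 v).N | Valued.v (((((m : ↥(unitaryGroupOfForm (conjLocal L (IsCMField.complexConj L) v) (cmLocalForm L 3 v))) : GL (Fin 3) (LocalRing L v)) : Matrix (Fin 3) (Fin 3) (LocalRing L v)) 0 2) w) = 1}, (fun n : ↥(cmBorelTriple L 3 v).N =>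
        if h : IsUnit ((((n : ↥(unitaryGroupOfForm (conjLocal L (IsCMField.complexConj L) v) (cmLocalForm L 3 v))) : GL (Fin 3) (LocalRing L v)) : Matrix (Fin 3) (Fin 3) (LocalRing L v)) 0 2) then
          ((((χ₁ (Units.map ((conjLocal L (IsCMField.complexConj L) v) : LocalRing L v →* LocalRing L v) h.unit))⁻¹ : ℂˣ) : ℂ) *
            ((((unitModulusChar (LocalRing L v) h.unit)⁻¹ : ℝ≥0) : ℝ) : ℂ))
        else 0) n ∂μ) + (∫ n in {m : ↥(cmBorelTriple L 3 v).N | Valued.v (((((m : ↥(unitaryGroupOfForm (conjLocal L (IsCMField.complexConj L) v) (cmLocalForm L 3 v))) : GL (Fin 3) (LocalRing L v)) : Matrix (Fin 3) (Fin 3) (LocalRing L v)) 0 2) w) = WithZero.exp (1 : ℤ)}, (fun n : ↥(cmBorelTriple L 3 v).N =>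
        if h : IsUnit ((((n : ↥(unitaryGroupOfForm (conjLocal L (IsCMField.complexConj L) v) (cmLocalForm L 3 v))) : GL (Fin 3) (LocalRing L v)) : Matrix (Fin 3) (Fin 3) (LocalRing L v)) 0 2) then
          ((((χ₁ (Units.map ((conjLocal L (IsCMField.complexConj L) v) : LocalRing L v →* LocalRing L v) h.unit))⁻¹ : ℂˣ) : ℂ) *
            ((((unitModulusChar (LocalRing L v) h.unit)⁻¹ : ℝ≥0) : ℝ) : ℂ))
        else 0) n ∂μ) +
        ((χ₁ (Units.map (conjLocal L (IsCMField.complexConj L) v : LocalRing L v →* LocalRing L v) piU * piU) : ℂˣ) : ℂ) * ∫ n in {m : ↥(cmBorelTriple L 3 v).N | 1 ≤ Valued.v (((((m : ↥(unitaryGroupOfForm (conjLocal L (IsCMField.complexConj L) v) (cmLocalForm L 3 v))) : GL (Fin 3) (LocalRing L v)) : Matrix (Fin 3) (Fin 3) (LocalRing L v)) 0 2) w)}, (fun n : ↥(cmBorelTriple L 3 v).N =>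
        if h : IsUnit ((((n : ↥(unitaryGroupOfForm (conjLocal L (IsCMField.complexConj L) v) (cmLocalForm L 3 v))) : GL (Fin 3) (LocalRing L v)) : Matrix (Fin 3) (Fin 3) (LocalRing L v)) 0 2) then
          ((((χ₁ (Units.map ((conjLocal L (IsCMField.complexConj L) v) : LocalRing L v →* LocalRing L v) h.unit))⁻¹ : ℂˣ) : ℂ) *
            ((((unitModulusChar (LocalRing L v) h.unit)⁻¹ : ℝ≥0) : ℝ) : ℂ))
        else 0) n ∂μ)
    (h1 : ∫ n in {m : ↥(cmBorelTriple L 3 v).N | Valued.v (((((m : ↥(unitaryGroupOfForm (conjLocal L (IsCMField.complexConj L) v) (cmLocalForm L 3 v))) : GL (Fin 3) (LocalRing L v)) : Matrix (Fin 3) (Fin 3) (LocalRing L v)) 0 2) w) = WithZero.exp (1 : ℤ)}, (fun n : ↥(cmBorelTriple L 3 v).N =>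
        if h : IsUnit ((((n : ↥(unitaryGroupOfForm (conjLocal L (IsCMField.complexConj L) v) (cmLocalForm L 3 v))) : GL (Fin 3) (LocalRing L v)) : Matrix (Fin 3) (Fin 3) (LocalRing L v)) 0 2) then
          ((((χ₁ (Units.map ((conjLocal L (IsCMField.complexConj L) v) : LocalRing L v →* LocalRing L v) h.unit))⁻¹ : ℂˣ) : ℂ) *
            ((((unitModulusChar (LocalRing L v) h.unit)⁻¹ : ℝ≥0) : ℝ) : ℂ))
        else 0) n ∂μ =
      0)
    (h0 : ∫ n in {m : ↥(cmBorelTriple L 3 v).N | Valued.v (((((m : ↥(unitaryGroupOfForm (conjLocal L (IsCMField.complexConj L) v) (cmLocalForm L 3 v))) : GL (Fin 3) (LocalRing L v)) : Matrix (Fin 3) (Fin 3) (LocalRing L v)) 0 2) w) = 1}, (fun n : ↥(cmBorelTriple L 3 v).N =>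
        if h : IsUnit ((((n : ↥(unitaryGroupOfForm (conjLocal L (IsCMField.complexConj L) v) (cmLocalForm L 3 v))) : GL (Fin 3) (LocalRing L v)) : Matrix (Fin 3) (Fin 3) (LocalRing L v)) 0 2) then
          ((((χ₁ (Units.map ((conjLocal L (IsCMField.complexConj L) v) : LocalRing L v →* LocalRing L v) h.unit))⁻¹ : ℂˣ) : ℂ) *
            ((((unitModulusChar (LocalRing L v) h.unit)⁻¹ : ℝ≥0) : ℝ) : ℂ))
        else 0) n ∂μ = c₀ * ((((Ideal.absNorm v.asIdeal : ℝ) : ℂ) - 1) / ((Ideal.absNorm v.asIdeal : ℝ) : ℂ)) * ((μ.real {m : ↥(cmBorelTriple L 3 v).N | Valued.v (((((m : ↥(unitaryGroupOfForm (conjLocal L (IsCMField.complexConj L) v) (cmLocalForm L 3 v))) : GL (Fin 3) (LocalRing L v)) : Matrix (Fin 3) (Fin 3) (LocalRing L v)) 0 2) w) ≤ 1} : ℝ) : ℂ))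
    (hred : ∃ N : Subrepresentation (cmPrincipalSeries L 3 v (cmTorusCharPair L v χ₁ 1)), N ≠ ⊥ ∧ N ≠ ⊤) :
    ∃ η : (LocalRing L v)ˣ →* ℂˣ, IsQuadraticCharExtension (conjLocal L (IsCMField.complexConj L) v) η ∧
      Continuous (fun x => ((η x : ℂˣ) : ℂ)) ∧ χ₁ = η * halfModulusChar (LocalRing L v) := by
  haveI := locallyCompactSpace_cmBorelU L 3 v
  -- `|X| < 1` (contraction: `σΠ·Π` has unit-modulus `q_w⁻² < 1`) for the closed forms
  have hX := norm_apply_norm_uniformizer_lt_one L v hns w hw piU hpiU χ₁ hcontr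
  -- the normalised `(I, χ̃)`-type basis (Branch B, depth zero; place-generic)
  obtain ⟨f₁, f_w, heig₁, heig_w, h11, h1g, hw1, hwg⟩ :=
    K2E3BranchBTypeBasisCM.exists_normalised_typeBasis_of_depthZero_of_normChar_eq_one L v w hw eA heA hϖ g₁ hg₁ K0 K1 I hK0 hK1 hI w₀ hw₀ χ₁ hdepth hB
  -- the ramified (II)-c heads for this basis
  have h11v := integral_weyl_one_eq_of_shells_ram L v w hw eA heA hϖ g₁ hg₁ K0 K1 I hK0 hK1 hI w₀ hw₀ χ₁ 1 μ f₁ heig₁ h11 h1g hSgt hSh0 hint _ c₀ hX hscal h1 h0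
  have hwwv := integral_weyl_weyl_eq_of_shells_ram L v w hw eA heA hϖ g₁ hg₁ K0 K1 I hK0 hK1 hI w₀ hw₀ χ₁ 1 μ f_w heig_w hw1 hwg hSge _ c₀ hX hscal h1 h0
  have hi₁₁ := K2E3BranchBCasselmanPairEntries.integrable_toFun_weyl_mul L v w hw eA heA hϖ g₁ hg₁ K0 K1 I hK0 hK1 hI w₀ hw₀ χ₁ 1 μ f₁ heig₁ h1g hSgt
    (hint.mono_set (fun m hm => by simp only [Set.mem_setOf_eq] at hm ⊢; exact le_of_lt hm))
  have hiw₂ := K2E3BranchBCasselmanPairEntries.integrable_toFun_conj_weyl L v w hw eA heA hϖ g₁ hg₁ K0 K1 I hK0 hK1 hI w₀ hw₀ χ₁ 1 μ f_w heig_w hw1 hSge hint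
  -- the sign `c := χ₂(−1)·c₀`, `c² = 1`
  have hc' : (((((1 : ↥(normOneUnits (conjLocal L (IsCMField.complexConj L) v)) →* ℂˣ)
      ⟨-1, F0P3cStCharTSBigCellFactorisation.neg_one_mem_normOneUnits (conjLocal L (IsCMField.complexConj L) v)⟩ : ℂˣ) : ℂ)) * c₀) ^ 2 = 1 := by
    rw [mul_pow, K2E3BranchBCasselmanPairEntries.chi2_neg_one_sq L v 1, one_mul, hc]
  exact exists_eta_of_reducible_of_bigCellEntries_ram L v w hw eA heA hϖ g₁ hg₁ K0 K1 I hK0 hK1 hI hns he h2w piU hpiU χ₁ h₁ hnu hcontr hdepth hB hram w₀ hw₀ μ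
    f₁ f_w heig₁ heig_w h11 h1g hw1 hwg hi₁₁ hiw₂ _ hc' h11v hwwv hred

/-! ## The same with the Borel-ness of the regions discharged (★ `K2E3BranchBShellRegions`, place-generic) -/

open Classical in
include hw heA hϖ hg₁ hK0 hK1 hI hw₀ in
set_option maxHeartbeats 4000000 in
set_option synthInstance.maxHeartbeats 400000 in
-- as above
/-- **THE SOCKET :155 AT A RAMIFIED PLACE, MODULO THE THREE RAMIFIED SHELL IDENTITIES — regions discharged.**  As `exists_eta_of_reducible_of_shells_ram`, without the three
measurability letters (the regions `S_gt`, `S_ge`, `Sh 0` are open ∕ closed in `N(L⁺_v)`, ★ `K2E3BranchBShellRegions`).  What remains hypothetical is exactly: `IntegrableOn F₀ S_ge`, the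
torus scaling by `Π` and the odd-shell vanishing (the ramified (II)-a), the shell-zero value `c₀·((q−1)∕q)·V` (the ramified (II)-b), and `c₀² = 1`. [cite: Keys1984, §3, §7 Theorem (2) (d) p. 126]
[cite: Casselman1980, §3] [cite: Casselman1995, §6.4, Thm. 6.6.2] [cite: Rogawski1990, §12.2 (1)–(2) p. 173] [cite: Roche1998, §3–§4] -/
theorem exists_eta_of_reducible_of_shellIdentities_ram
    (hns : ∀ w' : PlacesOver L v, IsCMField.complexConj L • w'.1 = w'.1)
    (he : v.asIdeal.ramificationIdx' w.1.asIdeal ≠ 1) (h2w : Valued.v (2 : w.1.adicCompletion L) = 1)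
    (piU : (LocalRing L v)ˣ) (hpiU : ∀ w' : PlacesOver L v, Valued.v ((piU : LocalRing L v) w') = WithZero.exp (-1 : ℤ))
    (χ₁ : (LocalRing L v)ˣ →* ℂˣ) (h₁ : Continuous fun x => ((χ₁ x : ℂˣ) : ℂ)) (hnu : ∃ x, ‖((χ₁ x : ℂˣ) : ℂ)‖ ≠ 1)
    (hcontr : ∀ x : (LocalRing L v)ˣ, unitModulusChar (LocalRing L v) x < 1 → ‖((χ₁ x : ℂˣ) : ℂ)‖ < 1)
    (hdepth : ∀ u : (LocalRing L v)ˣ, (∀ w' : PlacesOver L v, Valued.v (((u : LocalRing L v) w') - 1) < 1) → χ₁ u = 1)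
    (hB : ∀ u : (LocalRing L v)ˣ, (∀ w' : PlacesOver L v, Valued.v ((u : LocalRing L v) w') = 1) →
      χ₁ (u * Units.map (conjLocal L (IsCMField.complexConj L) v : LocalRing L v →* LocalRing L v) u) = 1)
    (hram : ¬ ∀ u ∈ (Submonoid.pi Set.univ (fun w' : PlacesOver L v => (w'.1.adicCompletionIntegers L).toSubring.toSubmonoid)).units, χ₁ u = 1)
    [MeasurableSpace ↥(cmBorelTriple L 3 v).N] [BorelSpace ↥(cmBorelTriple L 3 v).N] (μ : Measure ↥(cmBorelTriple L 3 v).N) [μ.IsHaarMeasure]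
    (hint : IntegrableOn (fun n : ↥(cmBorelTriple L 3 v).N =>
        if h : IsUnit ((((n : ↥(unitaryGroupOfForm (conjLocal L (IsCMField.complexConj L) v) (cmLocalForm L 3 v))) : GL (Fin 3) (LocalRing L v)) : Matrix (Fin 3) (Fin 3) (LocalRing L v)) 0 2) then
          ((((χ₁ (Units.map ((conjLocal L (IsCMField.complexConj L) v) : LocalRing L v →* LocalRing L v) h.unit))⁻¹ : ℂˣ) : ℂ) *
            ((((unitModulusChar (LocalRing L v) h.unit)⁻¹ : ℝ≥0) : ℝ) : ℂ))
        else 0) {m : ↥(cmBorelTriple L 3 v).N | 1 ≤ Valued.v (((((m : ↥(unitaryGroupOfForm (conjLocal L (IsCMField.complexConj L) v) (cmLocalForm L 3 v))) : GL (Fin 3) (LocalRing L v)) : Matrix (Fin 3) (Fin 3) (LocalRing L v)) 0 2) w)} μ)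
    (c₀ : ℂ) (hc : c₀ ^ 2 = 1)
    (hscal : ∫ n in {m : ↥(cmBorelTriple L 3 v).N | 1 ≤ Valued.v (((((m : ↥(unitaryGroupOfForm (conjLocal L (IsCMField.complexConj L) v) (cmLocalForm L 3 v))) : GL (Fin 3) (LocalRing L v)) : Matrix (Fin 3) (Fin 3) (LocalRing L v)) 0 2) w)}, (fun n : ↥(cmBorelTriple L 3 v).N =>
        if h : IsUnit ((((n : ↥(unitaryGroupOfForm (conjLocal L (IsCMField.complexConj L) v) (cmLocalForm L 3 v))) : GL (Fin 3) (LocalRing L v)) : Matrix (Fin 3) (Fin 3) (LocalRing L v)) 0 2) then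
          ((((χ₁ (Units.map ((conjLocal L (IsCMField.complexConj L) v) : LocalRing L v →* LocalRing L v) h.unit))⁻¹ : ℂˣ) : ℂ) *
            ((((unitModulusChar (LocalRing L v) h.unit)⁻¹ : ℝ≥0) : ℝ) : ℂ))
        else 0) n ∂μ =
      (∫ n in {m : ↥(cmBorelTriple L 3 v).N | Valued.v (((((m : ↥(unitaryGroupOfForm (conjLocal L (IsCMField.complexConj L) v) (cmLocalForm L 3 v))) : GL (Fin 3) (LocalRing L v)) : Matrix (Fin 3) (Fin 3) (LocalRing L v)) 0 2) w) = 1}, (fun n : ↥(cmBorelTriple L 3 v).N =>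
        if h : IsUnit ((((n : ↥(unitaryGroupOfForm (conjLocal L (IsCMField.complexConj L) v) (cmLocalForm L 3 v))) : GL (Fin 3) (LocalRing L v)) : Matrix (Fin 3) (Fin 3) (LocalRing L v)) 0 2) then
          ((((χ₁ (Units.map ((conjLocal L (IsCMField.complexConj L) v) : LocalRing L v →* LocalRing L v) h.unit))⁻¹ : ℂˣ) : ℂ) *
            ((((unitModulusChar (LocalRing L v) h.unit)⁻¹ : ℝ≥0) : ℝ) : ℂ))
        else 0) n ∂μ) + (∫ n in {m : ↥(cmBorelTriple L 3 v).N | Valued.v (((((m : ↥(unitaryGroupOfForm (conjLocal L (IsCMField.complexConj L) v) (cmLocalForm L 3 v))) : GL (Fin 3) (LocalRing L v)) : Matrix (Fin 3) (Fin 3) (LocalRing L v)) 0 2) w) = WithZero.exp (1 : ℤ)}, (fun n : ↥(cmBorelTriple L 3 v).N =>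
        if h : IsUnit ((((n : ↥(unitaryGroupOfForm (conjLocal L (IsCMField.complexConj L) v) (cmLocalForm L 3 v))) : GL (Fin 3) (LocalRing L v)) : Matrix (Fin 3) (Fin 3) (LocalRing L v)) 0 2) then
          ((((χ₁ (Units.map ((conjLocal L (IsCMField.complexConj L) v) : LocalRing L v →* LocalRing L v) h.unit))⁻¹ : ℂˣ) : ℂ) *
            ((((unitModulusChar (LocalRing L v) h.unit)⁻¹ : ℝ≥0) : ℝ) : ℂ))
        else 0) n ∂μ) +
        ((χ₁ (Units.map (conjLocal L (IsCMField.complexConj L) v : LocalRing L v →* LocalRing L v) piU * piU) : ℂˣ) : ℂ) * ∫ n in {m : ↥(cmBorelTriple L 3 v).N | 1 ≤ Valued.v (((((m : ↥(unitaryGroupOfForm (conjLocal L (IsCMField.complexConj L) v) (cmLocalForm L 3 v))) : GL (Fin 3) (LocalRing L v)) : Matrix (Fin 3) (Fin 3) (LocalRing L v)) 0 2) w)}, (fun n : ↥(cmBorelTriple L 3 v).N =>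
        if h : IsUnit ((((n : ↥(unitaryGroupOfForm (conjLocal L (IsCMField.complexConj L) v) (cmLocalForm L 3 v))) : GL (Fin 3) (LocalRing L v)) : Matrix (Fin 3) (Fin 3) (LocalRing L v)) 0 2) then
          ((((χ₁ (Units.map ((conjLocal L (IsCMField.complexConj L) v) : LocalRing L v →* LocalRing L v) h.unit))⁻¹ : ℂˣ) : ℂ) *
            ((((unitModulusChar (LocalRing L v) h.unit)⁻¹ : ℝ≥0) : ℝ) : ℂ))
        else 0) n ∂μ)
    (h1 : ∫ n in {m : ↥(cmBorelTriple L 3 v).N | Valued.v (((((m : ↥(unitaryGroupOfForm (conjLocal L (IsCMField.complexConj L) v) (cmLocalForm L 3 v))) : GL (Fin 3) (LocalRing L v)) : Matrix (Fin 3) (Fin 3) (LocalRing L v)) 0 2) w) = WithZero.exp (1 : ℤ)}, (fun n : ↥(cmBorelTriple L 3 v).N =>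
        if h : IsUnit ((((n : ↥(unitaryGroupOfForm (conjLocal L (IsCMField.complexConj L) v) (cmLocalForm L 3 v))) : GL (Fin 3) (LocalRing L v)) : Matrix (Fin 3) (Fin 3) (LocalRing L v)) 0 2) then
          ((((χ₁ (Units.map ((conjLocal L (IsCMField.complexConj L) v) : LocalRing L v →* LocalRing L v) h.unit))⁻¹ : ℂˣ) : ℂ) *
            ((((unitModulusChar (LocalRing L v) h.unit)⁻¹ : ℝ≥0) : ℝ) : ℂ))
        else 0) n ∂μ =
      0)
    (h0 : ∫ n in {m : ↥(cmBorelTriple L 3 v).N | Valued.v (((((m : ↥(unitaryGroupOfForm (conjLocal L (IsCMField.complexConj L) v) (cmLocalForm L 3 v))) : GL (Fin 3) (LocalRing L v)) : Matrix (Fin 3) (Fin 3) (LocalRing L v)) 0 2) w) = 1}, (fun n : ↥(cmBorelTriple L 3 v).N =>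
        if h : IsUnit ((((n : ↥(unitaryGroupOfForm (conjLocal L (IsCMField.complexConj L) v) (cmLocalForm L 3 v))) : GL (Fin 3) (LocalRing L v)) : Matrix (Fin 3) (Fin 3) (LocalRing L v)) 0 2) then
          ((((χ₁ (Units.map ((conjLocal L (IsCMField.complexConj L) v) : LocalRing L v →* LocalRing L v) h.unit))⁻¹ : ℂˣ) : ℂ) *
            ((((unitModulusChar (LocalRing L v) h.unit)⁻¹ : ℝ≥0) : ℝ) : ℂ))
        else 0) n ∂μ = c₀ * ((((Ideal.absNorm v.asIdeal : ℝ) : ℂ) - 1) / ((Ideal.absNorm v.asIdeal : ℝ) : ℂ)) * ((μ.real {m : ↥(cmBorelTriple L 3 v).N | Valued.v (((((m : ↥(unitaryGroupOfForm (conjLocal L (IsCMField.complexConj L) v) (cmLocalForm L 3 v))) : GL (Fin 3) (LocalRing L v)) : Matrix (Fin 3) (Fin 3) (LocalRing L v)) 0 2) w) ≤ 1} : ℝ) : ℂ))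
    (hred : ∃ N : Subrepresentation (cmPrincipalSeries L 3 v (cmTorusCharPair L v χ₁ 1)), N ≠ ⊥ ∧ N ≠ ⊤) :
    ∃ η : (LocalRing L v)ˣ →* ℂˣ, IsQuadraticCharExtension (conjLocal L (IsCMField.complexConj L) v) η ∧
      Continuous (fun x => ((η x : ℂˣ) : ℂ)) ∧ χ₁ = η * halfModulusChar (LocalRing L v) :=
  exists_eta_of_reducible_of_shells_ram L v w hw eA heA hϖ g₁ hg₁ K0 K1 I hK0 hK1 hI w₀ hw₀ hns he h2w piU hpiU χ₁ h₁ hnu hcontr hdepth hB hram μ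
    (K2E3BranchBShellRegions.measurableSet_setOf_one_lt_v L v w) (K2E3BranchBShellRegions.measurableSet_setOf_one_le_v L v w)
    (K2E3BranchBShellRegions.measurableSet_setOf_v_eq_one L v w) hint c₀ hc hscal h1 h0 hred

end Summit.HodgeConjecture.HodgeConjecture.R90.S1

end
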